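import Summits.BirchSwinnertonDyer.BirchSwinnertonDyer.Theorems.ByReductionTypeAtTwoSupersingularSharpTwo
import Literature.NumberTheory.EllipticCurves.PlusMinusPAdicLFunctionProofs
import Literature.NumberTheory.EllipticCurves.PAdicLFunctionIntegralityAtTwoProofs
import Literature.NumberTheory.EllipticCurves.LeadingTermPPartProofs
import Literature.NumberTheory.EllipticCurves.Rank1Residual.Predicates
import Literature.NumberTheory.Automorphic.ShimuraCurveRibetTakahashiOptimalModularityProofs
import HarnessLib

/-!
# Stub `stub_analyticSupplyAtTwo` (`AnalyticSupplyAtTwo`) of line `kolyvagin-char-two` (also VERBATIM S3 of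
# `pt_trivial_half`, S4 of `kato_big_image_member`) of the seed crux `SignedMuSeedAtTwoPlus`
# (stmt-BirchSwinnertonDyer-21438, route `ResidualThetaTransportAtTwo`): a POLLACK PAIR AT `2` EXISTS IN EVERY
# ANALYTIC RANK, and the analytic supply modulo modularity (width seat bsd-rtt-w7 g0; `--supports 21438`; closes nothing)

HONEST FRAMING. THEOREMS ONLY (no `def`, no new named fact, no `sorry`); BSD is not proved by any of this, nor is
the crux 21438. The registered stub reads (skeleton `Lines/kolyvagin_char_two.lean` 6de47a5c30e9e074)

  `AnalyticSupplyAtTwo : ∀ W [IsElliptic] [IsGloballyMinimal], GoodSS W 2 → a₂(W) = 0 →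
     ∃ (_ : NeZero N_W) (f : S₂(Γ₀(N_W))) (ϖ : ℚ) (L⁺ L⁻ : Λ), IsNewformOf W f ∧ ϖ · Ω_W = Ω⁺_f ∧ IsPollackPair f 2 L⁺ L⁻`

for EVERY such `W` (no analytic-rank hypothesis). `IsPollackPair` demands `L⁺ ≠ 0 ∧ L⁻ ≠ 0`; the tree's supply
`Theorems.exists_isPollackPair_two` proved this non-vanishing only from `L(W,1) ≠ 0` (analytic rank `0`), and the
earlier width memo (rtt-p4-w3 g6, `…PollackPairSupplyHabitat`) recorded «off analytic rank `0` this is Rohrlich's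
theorem, not in the tree». Rohrlich's theorem IS now a tree theorem (`Rohrlich1984_nonvanishing_twists_holds`), and
§9 of `PlusMinusPAdicLFunctionProofs` runs Pollack's Cor. 5.11 through it for ODD `p` (private lemmas). This file
ports that argument to `p = 2` (Mazur–Tate elements at level `2^{n+2}`, tree convention `Γ = 1 + 4ℤ₂`,
`cyclotomicExponent_two` of `PAdicLFunctionIntegralityAtTwoProofs`):

* `ratTwistedSymbolSum_eq_zero_of_isCongrModOmega_zero` — `θ_n ≡ ω · 0 (mod ω_n)` kills every Birch sum
  `∑ χ(a)[a/p^{n+e₀}]⁺_f` at an even `p`-power-order `χ` mod `p^{n+e₀}` (any prime `p`; public copy of the private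
  lemma of `PlusMinusPAdicLFunctionProofs`);
* `false_of_forall_ratTwistedSymbolSum_eq_zero` — Rohrlich forbids the vanishing of all Birch sums along a parity
  class of conductors `p^{2i+a+3}` (any prime `p`; public copy);
* `ne_zero_of_isCongrModOmega_even_two` / `ne_zero_of_isCongrModOmega_odd_two` — at `p = 2`, a `Λ`-element
  carrying the even (resp. odd) Mazur–Tate congruences of the newform of a curve with good reduction at `2` is
  non-zero (conductors `2^{2i+4}`, resp. `2^{2i+5}`);
* `exists_isPollackPair_two_of_isNewformOf` — **for every `W/ℚ` with good reduction at `2` and `a₂(W) = 0` and its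
  newform `f`, Sprung's pair at `2` exists and is a Pollack pair at `2`, IN EVERY ANALYTIC RANK** (the rank-`0`
  hypothesis `L(W,1) ≠ 0` of `exists_isPollackPair_two` removed);
* `exists_rat_mul_realPeriodRat_eq_plusPeriod_of_isNewformOf` — `∃ ϖ ∈ ℚ_{>0}, ϖ · Ω_W = Ω⁺_f` for the newform `f`
  of `W` (per curve, from `nonempty_modularParametrizationData_of_isNewformOf` + `IsNewformOf.unique`);
* `analyticSupplyAtTwo_of_isNewformOf` — the stub's conclusion for ONE curve given its newform (unconditional);
* `analyticSupplyAtTwo_of_modularParametrization` — **the stub's text VERBATIM from the route's own modularity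
  binder** `ModularParametrizationSupply` (item 19266) `= nonempty_modularParametrizationData` (BCDT 2001 Thm. A, named
  fact, BY NAME); `analyticSupplyAtTwo_of_exists_isNewformOf` — the same from the «Version L» spelling
  `exists_isNewformOf`.

So S4 is a THEOREM modulo the modularity input the route's `closes` already binds (`hmod`); with NO modularity
antecedent it is not closable in this tree (the modularity theorem is not formalised) — a re-typing of the stub as
`ModularParametrizationSupply → AnalyticSupplyAtTwo` closes it by `analyticSupplyAtTwo_of_modularParametrization`.

References: [Pollack2003] Cor. 5.11, Prop. 6.9/6.18; [RohrlichInventiones1984] Theorem p. 409;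
[MazurTateTeitelbaum1986Invent] §I.8 (8.6), §I.13; [Sprung2017] §1.1, Thm. 1.12, Cor. 4.4; [BCDTJAMS2001] Thm. A;
[EdixhovenManin1991] §1.
-/

set_option autoImplicit false
-- D-0017: single-problem summit, so `Summit.BirchSwinnertonDyer.BirchSwinnertonDyer.…` repeats a namespace BY DESIGN.
set_option linter.dupNamespace false

noncomputable section

open scoped Classical MatrixGroups ModularForm

open CongruenceSubgroup Polynomial WeierstrassCurve Literature.NumberTheory.EllipticCurves
  Literature.NumberTheory.EllipticCurves.ModularForms Literature.NumberTheory.EllipticCurves.Sprung2017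
  Literature.NumberTheory.EllipticCurves.Rank1Residual
  Summit.BirchSwinnertonDyer.Rank1Residual.Supersingular

namespace Summit.BirchSwinnertonDyer.BirchSwinnertonDyer.Theorems.SignedMuAtTwo.AnalyticSupply

/-! ## §1. Birch sums vanish under a null congruence; Rohrlich forbids it (any prime `p`) -/

section AnyPrime

variable {W : WeierstrassCurve ℚ} [W.IsElliptic] [W.IsGloballyMinimal] {N : ℕ}
  {f : CuspForm (Gamma0 N) 2} {p : ℕ} [Fact p.Prime]

/-- If `θ_n ≡ ω · 0 (mod ω_n)`, every Birch sum `∑_a χ(a)[a/p^{n+e₀}]⁺_f` at an even character `χ` of `p`-power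
order modulo `p^{n+e₀}` vanishes: evaluate the congruence at `χ(γ) − 1` (`IsCongrModOmega.eval₂_eq`,
`eval₂_mazurTateElement_eq_ratTwistedSymbolSum`). Any prime `p` (at `p = 2`, `e₀ = 2`). Public copy of the private
lemma of `PlusMinusPAdicLFunctionProofs` §9. [cite: Pollack2003, Prop. 6.9 (proof)] -/
theorem ratTwistedSymbolSum_eq_zero_of_isCongrModOmega_zero {n : ℕ} {ω : ℤ[X]}
    (h : IsCongrModOmega p n (mazurTateElement f p n) ω 0)
    (χ : DirichletCharacter ℂ_[p] (p ^ (n + cyclotomicExponent p))) (hev : χ.Even)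
    (hord : ∃ j : ℕ, orderOf χ = p ^ j) : ratTwistedSymbolSum f χ = 0 := by
  set ζ : ℂ_[p] := χ (cyclotomicGenerator p : ZMod (p ^ (n + cyclotomicExponent p))) with hζ
  have hpow : ζ ^ p ^ n = 1 := by
    rw [hζ, ← map_pow, ← orderOf_cyclotomicGenerator p n, pow_orderOf_eq_one, map_one]
  have hz : ‖ζ - 1‖ < 1 := norm_sub_one_lt_one_of_pow_prime_pow_eq_one hpow
  have hzn : (1 + (ζ - 1)) ^ p ^ n = 1 := by rwa [add_sub_cancel]
  have h1 := h.eval₂_eq hz hzn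
  rw [eval₂_mazurTateElement_eq_ratTwistedSymbolSum f χ hev hord] at h1
  rw [h1]
  simp

variable [NeZero N]

/-- **Rohrlich's theorem forbids the vanishing of all Birch sums along a parity class of levels**: if for some `a`
every primitive even `p`-power-order character `χ` of conductor `p^{2i+a+3}` (`i ≥ 0`) has
`∑_b χ(b)[b/p^{2i+a+3}]⁺_f = 0`, we reach a contradiction: by Birch's formula (`ratTwistedSymbolSum_mul_plusPeriod`,
a theorem from Eichler–Shimura `isZLattice_periodLattice_holds`) `L(E, χ̄, 1) = 0` for infinitely many primitive `χ`
of `p`-power conductor, against `Rohrlich1984_nonvanishing_twists_holds` (Rohrlich 1984, Theorem p. 409). Any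
prime `p`. Public copy of the private lemma of `PlusMinusPAdicLFunctionProofs` §9.
[cite: RohrlichInventiones1984, Theorem (p. 409)] -/
theorem false_of_forall_ratTwistedSymbolSum_eq_zero (hf : IsNewformOf W f)
    (hgood : W.HasGoodReductionAtPrime p) (a : ℕ)
    (hvan : ∀ (i : ℕ) (χ : DirichletCharacter ℂ_[p] (p ^ (2 * i + a + 3))), χ.IsPrimitive →
      χ.Even → (∃ j : ℕ, orderOf χ = p ^ j) → ratTwistedSymbolSum f χ = 0) : False := by
  have hp : p.Prime := Fact.out
  have hQ : coeffField f = ⊥ := hf.coeffField_eq_bot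
  have hpN : ¬ p ∣ N := not_dvd_level_of_isNewformOf hf hgood
  have hR := Rohrlich1984_nonvanishing_twists_holds.primePow hf.1 hpN
  have hB : ratTwistedSymbolSum_mul_plusPeriod (f := f) :=
    ratTwistedSymbolSum_mul_plusPeriod_of_lattice isZLattice_periodLattice_holds
      (exists_nsmul_modularSymbol_mem_periodLattice_of_isNewformOf hf)
  -- characters over `ℚ̄`, embedded into `ℂ` and `ℂ_p`
  let K := AlgebraicClosure ℚ
  let σ : K →+* ℂ := (@IsAlgClosed.lift ℂ _ _ ℚ _ _ K _ _ (AlgebraicClosure.instAlgebra ℚ) _ _ _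
    (AlgebraicClosure.isAlgebraic ℚ)).toRingHom
  let τ : K →+* ℂ_[p] := (@IsAlgClosed.lift ℂ_[p] _ _ ℚ _ _ K _ _
    (AlgebraicClosure.instAlgebra ℚ) _ _ _ (AlgebraicClosure.isAlgebraic ℚ)).toRingHom
  have hψ : ∀ i : ℕ, ∃ ψ : DirichletCharacter K (p ^ (2 * i + a + 3)),
      ψ.IsPrimitive ∧ ψ.Even ∧ ∃ j : ℕ, orderOf ψ = p ^ j := fun i ↦ by
    haveI : NeZero ((Nat.totient (p ^ (2 * i + a + 3)) : ℕ) : ℚ) :=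
      ⟨Nat.cast_ne_zero.mpr (Nat.totient_pos.mpr (pow_pos hp.pos _)).ne'⟩
    exact exists_isPrimitive_even_orderOf_eq_prime_pow K (2 * i + a)
  choose ψ hψprim hψeven hψord using hψ
  -- over `ℂ`, `L(f, (σψ_i)⁻¹, 1) = 0` for every `i`
  have hbad : ∀ i : ℕ, (⟨p ^ (2 * i + a + 3), ((ψ i).ringHomComp σ)⁻¹⟩ :
      Σ m : ℕ, DirichletCharacter ℂ m) ∈
      {χ : Σ m : ℕ, DirichletCharacter ℂ m |
        χ.1 ≠ 0 ∧ χ.1.primeFactors ⊆ {p} ∧ χ.2.IsPrimitive ∧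
          ∃ L : ℂ → ℂ, Differentiable ℂ L ∧
            (∀ s : ℂ, 2 < s.re → L s = twistedLSeries f χ.2 s) ∧ L 1 = 0} := by
    intro i
    haveI : NeZero (p ^ (2 * i + a + 3)) := ⟨pow_ne_zero _ hp.ne_zero⟩
    have hprimC : DirichletCharacter.IsPrimitive ((ψ i).ringHomComp σ) :=
      (isPrimitive_ringHomComp_iff σ (ψ i)).mpr (hψprim i)
    refine ⟨pow_ne_zero _ hp.ne_zero, (Nat.primeFactors_prime_pow (by omega) hp).le, ?_, ?_⟩
    · rw [DirichletCharacter.isPrimitive_def, DirichletCharacter.conductor_inv]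
      exact hprimC
    obtain ⟨L, hLd, hL⟩ := exists_differentiable_eq_twistedLSeries_holds f ((ψ i).ringHomComp σ)⁻¹
    refine ⟨L, hLd, hL, ?_⟩
    have hBirch := hB hf.1 hQ hprimC ((even_ringHomComp_iff σ (ψ i)).mpr (hψeven i)) hLd hL
    have hzero : ratTwistedSymbolSum f ((ψ i).ringHomComp σ) = 0 := by
      have hτ : ratTwistedSymbolSum f ((ψ i).ringHomComp τ) = 0 :=
        hvan i _ ((isPrimitive_ringHomComp_iff τ (ψ i)).mpr (hψprim i))
          ((even_ringHomComp_iff τ (ψ i)).mpr (hψeven i))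
          (by rw [orderOf_ringHomComp]; exact hψord i)
      rw [ratTwistedSymbolSum_ringHomComp, map_eq_zero] at hτ
      rw [ratTwistedSymbolSum_ringHomComp, hτ, map_zero]
    rw [hzero, zero_mul, eq_comm, mul_eq_zero] at hBirch
    exact hBirch.resolve_left (gaussSum_stdAddChar_ne_zero hprimC)
  -- infinitely many distinct characters, contradicting Rohrlich
  let F : ℕ → Σ m : ℕ, DirichletCharacter ℂ m := fun i ↦
    ⟨p ^ (2 * i + a + 3), ((ψ i).ringHomComp σ)⁻¹⟩
  have hFinj : Function.Injective F := fun i l h ↦ by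
    have h1 : p ^ (2 * i + a + 3) = p ^ (2 * l + a + 3) := congr_arg Sigma.fst h
    have := Nat.pow_right_injective hp.two_le h1
    omega
  have hfin : (Set.univ : Set ℕ).Finite := by
    refine (hR.preimage hFinj.injOn).subset fun i _ ↦ ?_
    exact hbad i
  exact Set.infinite_univ hfin

end AnyPrime

/-! ## §2. Non-vanishing of the `♯/♭` pair at `p = 2` in every analytic rank -/

section Two

variable {W : WeierstrassCurve ℚ} [W.IsElliptic] [W.IsGloballyMinimal] {N : ℕ} [NeZero N]
  {f : CuspForm (Gamma0 N) 2}

/-- **`L⁻ ≠ 0` at `p = 2`, any analytic rank**: a `Λ`-element `L` carrying congruences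
`θ_n ≡ ω(n) · L (mod ω_n)` for every EVEN `n` (for the newform `f` of a curve `W` with good reduction at `2`) is
non-zero — otherwise every Birch sum at a primitive even `2`-power-order character of conductor `2^{2i+4}`
(`= 2^{n+2}`, `n = 2i+2`) would vanish, against Rohrlich (Pollack 2003, Cor. 5.11, at `p = 2`).
[cite: Pollack2003, Cor. 5.11] [cite: RohrlichInventiones1984, Theorem (p. 409)] -/
theorem ne_zero_of_isCongrModOmega_even_two (hf : IsNewformOf W f) (hgood : W.HasGoodReductionAtPrime 2)
    {L : IwasawaAlgebra 2} {ω : ℕ → ℤ[X]}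
    (hL : ∀ n : ℕ, Even n → IsCongrModOmega 2 n (mazurTateElement f 2 n) (ω n) L) : L ≠ 0 := by
  intro hL0
  subst hL0
  refine false_of_forall_ratTwistedSymbolSum_eq_zero hf hgood 1 fun i χ _ hev hord ↦ ?_
  -- level `2^{2i+4} = 2^{(2i+2) + e₀}`
  have hlev : ∀ (M : ℕ) (_ : M = 2 * (i + 1) + cyclotomicExponent 2)
      (χ : DirichletCharacter ℂ_[2] (2 ^ M)), χ.Even → (∃ j : ℕ, orderOf χ = 2 ^ j) →
      ratTwistedSymbolSum f χ = 0 := by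
    intro M hM χ hev hord
    subst hM
    exact ratTwistedSymbolSum_eq_zero_of_isCongrModOmega_zero (hL (2 * (i + 1)) (even_two_mul _)) χ hev hord
  exact hlev (2 * i + 1 + 3) (by rw [cyclotomicExponent_two]; ring) χ hev hord

/-- **`L⁺ ≠ 0` at `p = 2`, any analytic rank**: likewise from congruences at every ODD `n` (conductors `2^{2i+5}`,
`n = 2i+3`). [cite: Pollack2003, Cor. 5.11] [cite: RohrlichInventiones1984, Theorem (p. 409)] -/
theorem ne_zero_of_isCongrModOmega_odd_two (hf : IsNewformOf W f) (hgood : W.HasGoodReductionAtPrime 2)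
    {L : IwasawaAlgebra 2} {ω : ℕ → ℤ[X]}
    (hL : ∀ n : ℕ, Odd n → IsCongrModOmega 2 n (mazurTateElement f 2 n) (ω n) L) : L ≠ 0 := by
  intro hL0
  subst hL0
  refine false_of_forall_ratTwistedSymbolSum_eq_zero hf hgood 2 fun i χ _ hev hord ↦ ?_
  -- level `2^{2i+5} = 2^{(2i+3) + e₀}`
  have hlev : ∀ (M : ℕ) (_ : M = (2 * (i + 1) + 1) + cyclotomicExponent 2)
      (χ : DirichletCharacter ℂ_[2] (2 ^ M)), χ.Even → (∃ j : ℕ, orderOf χ = 2 ^ j) →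
      ratTwistedSymbolSum f χ = 0 := by
    intro M hM χ hev hord
    subst hM
    exact ratTwistedSymbolSum_eq_zero_of_isCongrModOmega_zero (hL (2 * (i + 1) + 1) (odd_two_mul_add_one _))
      χ hev hord
  exact hlev (2 * i + 2 + 3) (by rw [cyclotomicExponent_two]; ring) χ hev hord

/-- **A Pollack pair at `2` EXISTS for the newform of every `E/ℚ` with good reduction at `2` and `a₂(E) = 0`, in
EVERY analytic rank**: Sprung's pair `(L♯, L♭)` at `2` exists (`exists_isSprungPair_two`), its congruence clauses
are Pollack's at `a₂ = 0` (`isSprungPair_zero_iff`), and BOTH members are non-zero by Rohrlich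
(`ne_zero_of_isCongrModOmega_odd_two` / `…_even_two`) — the rank-free form of `Theorems.exists_isPollackPair_two`
(which assumed `L(E,1) ≠ 0`). [cite: Sprung2017, §1.1, Thm. 1.12 and Cor. 4.4] [cite: Pollack2003, Cor. 5.11 and Prop. 6.18] -/
theorem exists_isPollackPair_two_of_isNewformOf (hf : IsNewformOf W f) (hgood : W.HasGoodReductionAtPrime 2)
    (ha : W.frobeniusTrace 2 = 0) :
    ∃ Lsharp Lflat : IwasawaAlgebra 2,
      IsSprungPair f 2 (W.frobeniusTrace 2) Lsharp Lflat ∧ IsPollackPair f 2 Lsharp Lflat := by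
  obtain ⟨Ls, Lf, hSP⟩ := exists_isSprungPair_two hf hgood (by rw [ha]; exact dvd_zero 2)
  refine ⟨Ls, Lf, hSP, ?_⟩
  have hSP0 : IsSprungPair f 2 0 Ls Lf := by rw [← ha]; exact hSP
  obtain ⟨hodd, heven⟩ := (isSprungPair_zero_iff f 2 Ls Lf).mp hSP0
  exact ⟨ne_zero_of_isCongrModOmega_odd_two hf hgood (fun n hn ↦ hodd n hn),
    ne_zero_of_isCongrModOmega_even_two hf hgood (fun n hn ↦ heven n hn), hodd, heven⟩

/-- Rank-free `∃ L⁺ L⁻, IsPollackPair f 2 L⁺ L⁻` for the newform of every `E/ℚ` with good reduction at `2` and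
`a₂(E) = 0` (drops the `IsSprungPair` conjunct of `exists_isPollackPair_two_of_isNewformOf`).
[cite: Sprung2017, §1.1, Thm. 1.12 and Cor. 4.4] [cite: Pollack2003, Cor. 5.11 and Prop. 6.18] -/
theorem exists_isPollackPair_two_anyRank (hf : IsNewformOf W f) (hgood : W.HasGoodReductionAtPrime 2)
    (ha : W.frobeniusTrace 2 = 0) : ∃ Lplus Lminus : IwasawaAlgebra 2, IsPollackPair f 2 Lplus Lminus := by
  obtain ⟨Ls, Lf, -, hP⟩ := exists_isPollackPair_two_of_isNewformOf hf hgood ha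
  exact ⟨Ls, Lf, hP⟩

/-! ## §3. The period ratio and the analytic supply -/

omit [W.IsGloballyMinimal] in
/-- **The period ratio for the newform of `W`**: if `f ∈ S₂(Γ₀(N))` is the newform of `W` then there is a positive
rational `ϖ` with `ϖ · Ω(W) = Ω⁺_f` — the modular parametrisation datum of `W` at level `N` exists from `f` alone
(`nonempty_modularParametrizationData_of_isNewformOf`, BCDT (2) ⇒ (6) per curve), its newform IS `f`
(`IsNewformOf.unique`, `q`-expansion principle), and `ModularParametrizationData.exists_rat_mul_realPeriodRat_eq_plusPeriod`
(Edixhoven 1991 §1: `m · Ω(W) = |c| · Ω⁺_f`). [cite: EdixhovenManin1991, §1] [cite: BCDTJAMS2001, Thm. A with (6) of p. 845] -/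
theorem exists_rat_mul_realPeriodRat_eq_plusPeriod_of_isNewformOf (hf : IsNewformOf W f) :
    ∃ ϖ : ℚ, 0 < ϖ ∧ (ϖ : ℝ) * W.realPeriodRat = plusPeriod f ∧ 0 < W.realPeriodRat := by
  obtain ⟨D⟩ := Literature.NumberTheory.Automorphic.nonempty_modularParametrizationData_of_isNewformOf hf
  have hDf : D.f = f := D.isNewformOf.unique hf
  obtain ⟨ϖ, hϖ0, hϖ, hΩ⟩ := D.exists_rat_mul_realPeriodRat_eq_plusPeriod
  exact ⟨ϖ, hϖ0, by rw [hϖ, hDf], hΩ⟩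

/-- **The analytic supply at `2` for ONE curve, given its newform (unconditional).** For `W/ℚ` globally minimal, good
supersingular at `2` with `a₂(W) = 0`, and `f ∈ S₂(Γ₀(N_W))` its newform: a rational `ϖ` with `ϖ · Ω_W = Ω⁺_f` and a
Pollack pair at `2` exist — the conclusion of the registered stub `AnalyticSupplyAtTwo` for this `W`, with `f` the
given newform. [cite: Sprung2017, §1.1, Thm. 1.12 and Cor. 4.4] [cite: EdixhovenManin1991, §1] -/
theorem analyticSupplyAtTwo_of_isNewformOf (W : WeierstrassCurve ℚ) [W.IsElliptic] [W.IsGloballyMinimal]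
    (hss : GoodSS W 2) (ha : W.frobeniusTrace 2 = 0) [NeZero (W.conductorNorm ℤ)]
    (f : CuspForm (Gamma0 (W.conductorNorm ℤ)) 2) (hf : IsNewformOf W f) :
    ∃ (ϖ : ℚ) (Lplus Lminus : IwasawaAlgebra 2),
      (ϖ : ℝ) * W.realPeriodRat = plusPeriod f ∧ IsPollackPair f 2 Lplus Lminus := by
  obtain ⟨ϖ, -, hϖ, -⟩ := exists_rat_mul_realPeriodRat_eq_plusPeriod_of_isNewformOf hf
  obtain ⟨Ls, Lf, hP⟩ := exists_isPollackPair_two_anyRank hf hss.1 ha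
  exact ⟨ϖ, Ls, Lf, hϖ, hP⟩

/-- **`AnalyticSupplyAtTwo` from the route's modularity binder.** Granted `nonempty_modularParametrizationData` (BCDT
2001 Thm. A as parametrisation data; BY NAME = item 19266 `ModularParametrizationSupply` of route
`ResidualThetaTransportAtTwo`, a binder of its `closes`), the registered stub `AnalyticSupplyAtTwo` of
`Cruxes/SignedMuSeedAtTwoPlus/Lines/kolyvagin_char_two.lean` holds VERBATIM: for every `W/ℚ` globally minimal, good
supersingular at `2` with `a₂(W) = 0`, there are its newform `f` of level `N_W`, a rational `ϖ` with
`ϖ · Ω_W = Ω⁺_f`, and a Pollack pair at `2` — in every analytic rank.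
[cite: BCDTJAMS2001, Thm. A] [cite: Sprung2017, §1.1, Thm. 1.12 and Cor. 4.4] [cite: Pollack2003, Cor. 5.11 and Prop. 6.18] -/
theorem analyticSupplyAtTwo_of_modularParametrization (hmod : nonempty_modularParametrizationData) :
    ∀ (W : WeierstrassCurve ℚ) [W.IsElliptic] [W.IsGloballyMinimal], GoodSS W 2 → W.frobeniusTrace 2 = 0 →
    ∃ (_ : NeZero (W.conductorNorm ℤ)) (f : CuspForm (Gamma0 (W.conductorNorm ℤ)) 2) (ϖ : ℚ)
      (Lplus Lminus : IwasawaAlgebra 2),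
      IsNewformOf W f ∧ (ϖ : ℝ) * W.realPeriodRat = plusPeriod f ∧ IsPollackPair f 2 Lplus Lminus := by
  intro W _ _ hss ha
  haveI hN : NeZero (W.conductorNorm ℤ) := ⟨(W.conductorNorm_pos_holds).ne'⟩
  obtain ⟨D⟩ := hmod W
  obtain ⟨ϖ, -, hϖ, -⟩ := D.exists_rat_mul_realPeriodRat_eq_plusPeriod
  obtain ⟨Ls, Lf, hP⟩ := exists_isPollackPair_two_anyRank D.isNewformOf hss.1 ha
  exact ⟨hN, D.f, ϖ, Ls, Lf, D.isNewformOf, hϖ, hP⟩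

/-- **`AnalyticSupplyAtTwo` from the «Version L» modularity fact** `exists_isNewformOf` (Diamond–Shurman Thm. 8.8.3;
BCDT 2001 Thm. A): the same conclusion, VERBATIM the registered stub's text.
[cite: DiamondShurman2005, Thm. 8.8.3] [cite: Sprung2017, §1.1, Thm. 1.12 and Cor. 4.4] -/
theorem analyticSupplyAtTwo_of_exists_isNewformOf (hmod : exists_isNewformOf) :
    ∀ (W : WeierstrassCurve ℚ) [W.IsElliptic] [W.IsGloballyMinimal], GoodSS W 2 → W.frobeniusTrace 2 = 0 →
    ∃ (_ : NeZero (W.conductorNorm ℤ)) (f : CuspForm (Gamma0 (W.conductorNorm ℤ)) 2) (ϖ : ℚ)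
      (Lplus Lminus : IwasawaAlgebra 2),
      IsNewformOf W f ∧ (ϖ : ℝ) * W.realPeriodRat = plusPeriod f ∧ IsPollackPair f 2 Lplus Lminus := by
  intro W _ _ hss ha
  haveI hN : NeZero (W.conductorNorm ℤ) := ⟨(W.conductorNorm_pos_holds).ne'⟩
  obtain ⟨f, hf⟩ := hmod W
  obtain ⟨ϖ, Ls, Lf, hϖ, hP⟩ := analyticSupplyAtTwo_of_isNewformOf W hss ha f hf
  exact ⟨hN, f, ϖ, Ls, Lf, hf, hϖ, hP⟩

end Two

end Summit.BirchSwinnertonDyer.BirchSwinnertonDyer.Theorems.SignedMuAtTwo.AnalyticSupply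


/-! ## §4 (appended) The rank-free Pollack-pair supply at `2` in the spelling of line `sign_dichotomy` (S5) -/

namespace Summit.BirchSwinnertonDyer.BirchSwinnertonDyer.Theorems.SignedMuAtTwo.AnalyticSupply

/-- **`PollackPairSupplyAtTwo` (stub S5 of the archived line `sign_dichotomy` of 21438) VERBATIM from the modularity binder**:
granted `nonempty_modularParametrizationData` (item 19266 `ModularParametrizationSupply`), every `W/ℚ` globally minimal, good
supersingular at `2` with `a₂(W) = 0`, has a newform `f` (at level `N_W`) with a Pollack pair at `2` — in EVERY analytic rank
(the earlier helper `SignDichotomy.pollackPairSupplyAtTwo_habitat_of_modularity` needed `W.analyticRank = 0`).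
[cite: BCDTJAMS2001, Thm. A] [cite: Sprung2017, §1.1, Thm. 1.12 and Cor. 4.4] [cite: Pollack2003, Cor. 5.11 and Prop. 6.18] -/
theorem pollackPairSupplyAtTwo_of_modularParametrization (hmod : nonempty_modularParametrizationData) :
    ∀ (W : WeierstrassCurve ℚ) [W.IsElliptic] [W.IsGloballyMinimal], GoodSS W 2 → W.frobeniusTrace 2 = 0 →
      ∃ (N : ℕ) (_ : NeZero N) (f : CuspForm (Gamma0 N) 2), IsNewformOf W f ∧
        ∃ (Lplus Lminus : IwasawaAlgebra 2), IsPollackPair f 2 Lplus Lminus := by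
  intro W _ _ hss ha
  obtain ⟨hN, f, -, Ls, Lf, hf, -, hP⟩ := analyticSupplyAtTwo_of_modularParametrization hmod W hss ha
  exact ⟨W.conductorNorm ℤ, hN, f, hf, Ls, Lf, hP⟩

/-- The same from the «Version L» modularity fact `exists_isNewformOf` (Diamond–Shurman Thm. 8.8.3).
[cite: DiamondShurman2005, Thm. 8.8.3] [cite: Sprung2017, §1.1, Thm. 1.12 and Cor. 4.4] -/
theorem pollackPairSupplyAtTwo_of_exists_isNewformOf (hmod : exists_isNewformOf) :
    ∀ (W : WeierstrassCurve ℚ) [W.IsElliptic] [W.IsGloballyMinimal], GoodSS W 2 → W.frobeniusTrace 2 = 0 →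
      ∃ (N : ℕ) (_ : NeZero N) (f : CuspForm (Gamma0 N) 2), IsNewformOf W f ∧
        ∃ (Lplus Lminus : IwasawaAlgebra 2), IsPollackPair f 2 Lplus Lminus := by
  intro W _ _ hss ha
  obtain ⟨hN, f, -, Ls, Lf, hf, -, hP⟩ := analyticSupplyAtTwo_of_exists_isNewformOf hmod W hss ha
  exact ⟨W.conductorNorm ℤ, hN, f, hf, Ls, Lf, hP⟩

/-- Per curve, unconditional: the newform `f` (any level `N`) of a curve `W` with good reduction at `2` and `a₂(W) = 0`
admits a Pollack pair at `2` — the conclusion of `SignDichotomy.pollackPairSupplyAtTwo_of_isNewformOf` WITHOUT its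
hypothesis `W.analyticRank = 0`. [cite: Sprung2017, §1.1, Thm. 1.12 and Cor. 4.4] [cite: Pollack2003, Cor. 5.11 and Prop. 6.18] -/
theorem pollackPairSupplyAtTwo_of_isNewformOf_anyRank (W : WeierstrassCurve ℚ) [W.IsElliptic] [W.IsGloballyMinimal]
    (hss : GoodSS W 2) (ha : W.frobeniusTrace 2 = 0) {N : ℕ} [NeZero N] (f : CuspForm (Gamma0 N) 2)
    (hf : IsNewformOf W f) : ∃ Lplus Lminus : IwasawaAlgebra 2, IsPollackPair f 2 Lplus Lminus :=
  exists_isPollackPair_two_anyRank hf hss.1 ha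

end Summit.BirchSwinnertonDyer.BirchSwinnertonDyer.Theorems.SignedMuAtTwo.AnalyticSupply

end
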